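import Literature.NumberTheory.EllipticCurves.GaloisAction
import Literature.NumberTheory.EllipticCurves.GlobalMinimalModel
import Literature.NumberTheory.EllipticCurves.Tamagawa
import HarnessLib

/-!
# Reducibility of `E[p]` from the Eisenstein congruences `a_ℓ ≡ ℓ + 1 (mod p)` (named fact)

Topic `NumberTheory/EllipticCurves` (trunk T-ELLARITH). D-0014 keeps `Literature/` sorry-free by
stating cited results as named facts `def X : Prop`.

This file vendors one arithmetic input of the integrality of the `p`-adic `L`-function
`L_p(E, T) ∈ Λ` under irreducibility of `E[p]` (`Literature.NumberTheory.EllipticCurves.padicLFunction_mem_integral`,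
Greenberg–Vatsal 2000, Prop. 3.7; consumed by
`Literature.NumberTheory.EllipticCurves.PAdicLFunctionIntegralityProofs`): the link between the
mod-`p` Galois representation `ρ̄_{E,p} : Γ_ℚ → Aut(E[p]) ≅ GL₂(𝔽_p)` of an elliptic curve `E / ℚ`
(item G06, `WeierstrassCurve.galoisRepTorsion`, `WeierstrassCurve.HasIrreducibleModPGaloisRep`)
and the traces of Frobenius `a_ℓ(E) = ℓ + 1 - #Ẽ(𝔽_ℓ)` (`WeierstrassCurve.frobeniusTrace`):

* `Literature.NumberTheory.EllipticCurves.not_irreducible_of_frobeniusTrace_congr` (named fact): if `a_ℓ(E) ≡ ℓ + 1 (mod p)`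
  (equivalently `p ∣ #Ẽ(𝔽_ℓ)`) for **every** prime `ℓ ≠ p` of good reduction, then `E[p]` is a
  reducible `Γ_ℚ`-module.

This is the standard consequence of the Chebotarev density theorem and the Brauer–Nesbitt
theorem, as printed in Darmon–Diamond–Taylor 1995: by Prop. 2.11(a) (PDF p. 57), for a prime
`ℓ ≠ p` of good reduction `ρ_{E,p}` is unramified at `ℓ` and
`tr ρ_{E,p}(Frob_ℓ) = ℓ + 1 - #Ẽ(𝔽_ℓ)`; by Prop. 2.8(a) (PDF p. 56) `det ρ_{E,p} = ε` is the
cyclotomic character; hence under the hypothesis the semisimplification `ρ̄^{ss}` of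
`ρ̄ = ρ̄_{E,p}` and the semisimple representation `1 ⊕ ε̄` have the same `tr ∧^i(Frob_ℓ)`
(`i = 1, 2`: trace `1 + ℓ`, determinant `ℓ`) at every prime `ℓ ∉ S = {p} ∪ {bad primes}`, so by
Prop. 2.6(b) (PDF p. 53: "a semi-simple mod `ℓ` representation `ρ : G_ℚ → GL_d(k)` is determined
by the values of `tr ∧^i ρ(Frob_p)` (`i = 1, …, d`) on the primes `p ∉ S` at which `ρ` is
unramified"; proof: Chebotarev density and Brauer–Nesbitt) `ρ̄^{ss} ≅ 1 ⊕ ε̄`; an irreducible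
`ρ̄` would be its own semisimplification, so `ρ̄` is reducible, i.e. `E[p]` has a `Γ_ℚ`-stable
subgroup other than `0` and `E[p]`. In point-count form this is also the case `m = p` of Katz
1981, Thm. 2 ("if `#E(𝔽_ℓ) ≡ 0 (mod m)` for almost all `ℓ` then `E` is `ℚ`-isogenous to a curve
with a rational point of order `m`"; a rational `p`-torsion point in the isogeny class makes
`E[p]` reducible).

* `Literature.NumberTheory.EllipticCurves.frobeniusTrace_sub_eq_neg_reductionPointCount`, `Literature.NumberTheory.EllipticCurves.dvd_frobeniusTrace_sub_iff` (proved):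
  `a_ℓ - (ℓ + 1) = -#Ẽ(𝔽_ℓ)`, so the congruence is `p ∣ #Ẽ(𝔽_ℓ)` (Katz's form).
* `Literature.NumberTheory.EllipticCurves.exists_prime_not_dvd_frobeniusTrace_sub` (proved from the fact): if `E[p]` is irreducible
  there is a good prime `ℓ ≠ p` with `a_ℓ ≢ ℓ + 1 (mod p)` — the form used for integrality of
  modular symbols (a prime `ℓ` at which the Eisenstein ideal `(T_ℓ - ℓ - 1)` is a unit mod `p`).

Mathlib has neither Frobenius elements of `Γ_ℚ` at unramified primes, nor the Chebotarev density
theorem, nor Brauer–Nesbitt for profinite groups (searched `Chebotarev`, `BrauerNesbitt`,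
`frobenius` in `NumberTheory`); the tree's `Literature.NumberTheory.GaloisRepresentations` has
framed Galois representations but no bridge to `WeierstrassCurve.galoisRepTorsion`, whence a named
fact rather than a proof.

## References

* H. Darmon, F. Diamond, R. Taylor, *Fermat's Last Theorem*, Current Developments in Mathematics
  1995, International Press, 1–154: Thm. 2.3 (Chebotarev), Prop. 2.6(b), Prop. 2.8(a),
  Prop. 2.11(a) (PDF pp. 52–57).
* N. M. Katz, *Galois properties of torsion points on abelian varieties*, Invent. Math. 62
  (1981), 481–502, Thm. 2.
* J.-P. Serre, *Propriétés galoisiennes des points d'ordre fini des courbes elliptiques*, Invent.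
  Math. 15 (1972), §4.
* R. Greenberg, V. Vatsal, *On the Iwasawa invariants of elliptic curves*, Invent. Math. 142
  (2000), p. 32 ("`ρ_𝔪` … characterized by `Tr(ρ_𝔪(Frob(q))) = T_q` … is the semisimplification
  of the representation of `G_ℚ` on `E[p]`") and Prop. 3.7.
-/

namespace Literature.NumberTheory.EllipticCurves

/-- **`E[p]` is reducible when all Frobenius traces are Eisenstein mod `p`** (Chebotarev density
+ Brauer–Nesbitt; Darmon–Diamond–Taylor 1995, Prop. 2.6(b) with Prop. 2.8(a) and Prop. 2.11(a);
Katz 1981, Thm. 2, case `m = p`, in point-count form). Let `E = W / ℚ` be an elliptic curve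
(globally minimal Weierstrass model, so that `a_ℓ(W) = ℓ + 1 - #W̃(𝔽_ℓ)` is the trace of
Frobenius at a good prime `ℓ`) and `p` a prime. If `a_ℓ(E) ≡ ℓ + 1 (mod p)` — equivalently
`p ∣ #Ẽ(𝔽_ℓ)` (`dvd_frobeniusTrace_sub_iff`) — for every prime `ℓ ≠ p` of good reduction, then
the mod-`p` representation `E[p]` of `Γ_ℚ` is reducible: by DDT Prop. 2.11(a)
(`tr ρ_{E,p}(Frob_ℓ) = ℓ + 1 - #Ẽ(𝔽_ℓ)` for good `ℓ ≠ p`) and Prop. 2.8(a) (`det ρ_{E,p} = ε`),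
the semisimplification of `ρ̄_{E,p}` and `1 ⊕ ε̄` have the same characteristic polynomials of
`Frob_ℓ` for all `ℓ ∉ {p} ∪ {bad primes}`, hence are isomorphic by Prop. 2.6(b) (Chebotarev +
Brauer–Nesbitt), and an irreducible `ρ̄_{E,p}` would equal its semisimplification. In the tree's
language (`WeierstrassCurve.HasIrreducibleModPGaloisRep`, item G06): `E[p] = W.geomTorsion p` has a
`Γ_ℚ`-stable subgroup other than `⊥` and `⊤`.
[cite: DarmonDiamondTaylor1995, Prop. 2.6(b), Prop. 2.8(a), Prop. 2.11(a) (PDF pp. 53–57)] -/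
def not_irreducible_of_frobeniusTrace_congr : Prop :=
  ∀ (W : WeierstrassCurve ℚ) [W.IsElliptic] [W.IsGloballyMinimal] (p : ℕ) [Fact p.Prime],
    (∀ (ℓ : ℕ) [Fact ℓ.Prime], ℓ ≠ p → W.HasGoodReductionAtPrime ℓ →
        (p : ℤ) ∣ W.frobeniusTrace ℓ - (ℓ + 1)) →
      ¬ W.HasIrreducibleModPGaloisRep p

/-- `a_ℓ(W) - (ℓ + 1) = -#W̃(𝔽_ℓ)` (`a_ℓ = ℓ + 1 - #W̃(𝔽_ℓ)` by definition of
`WeierstrassCurve.frobeniusTrace`). [folklore] -/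
theorem frobeniusTrace_sub_eq_neg_reductionPointCount (W : WeierstrassCurve ℚ)
    [W.IsGloballyMinimal] (ℓ : ℕ) :
    W.frobeniusTrace ℓ - (ℓ + 1) = -(W.reductionPointCount ℓ : ℤ) := by
  rw [WeierstrassCurve.frobeniusTrace]
  ring

/-- The Eisenstein congruence `a_ℓ ≡ ℓ + 1 (mod p)` is `p ∣ #W̃(𝔽_ℓ)` (Katz 1981, Thm. 2,
hypothesis "`#E(𝔽_ℓ) ≡ 0 mod m`"). [folklore] -/
theorem dvd_frobeniusTrace_sub_iff (W : WeierstrassCurve ℚ) [W.IsGloballyMinimal] (p ℓ : ℕ) :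
    (p : ℤ) ∣ W.frobeniusTrace ℓ - (ℓ + 1) ↔ p ∣ W.reductionPointCount ℓ := by
  rw [frobeniusTrace_sub_eq_neg_reductionPointCount, dvd_neg, Int.natCast_dvd_natCast]

/-- **A good prime with non-Eisenstein trace, from irreducibility of `E[p]`**: if `E[p]` is an
irreducible `Γ_ℚ`-module then some prime `ℓ ≠ p` of good reduction has `a_ℓ(E) ≢ ℓ + 1 (mod p)`,
i.e. `p ∤ #Ẽ(𝔽_ℓ)` (contrapositive of the named fact `not_irreducible_of_frobeniusTrace_congr`;
Darmon–Diamond–Taylor 1995, Prop. 2.6(b); Katz 1981, Thm. 2). This is the form in which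
irreducibility enters the `p`-integrality of the modular symbols `[a/pⁿ]⁺` (the Hecke operator
`T_ℓ - ℓ - 1` kills `{∞, 0}` modulo integral homology).
[cite: DarmonDiamondTaylor1995, Prop. 2.6(b) (PDF p. 53)] -/
theorem exists_prime_not_dvd_frobeniusTrace_sub (h : not_irreducible_of_frobeniusTrace_congr)
    (W : WeierstrassCurve ℚ) [W.IsElliptic] [W.IsGloballyMinimal] (p : ℕ) [Fact p.Prime]
    (hirr : W.HasIrreducibleModPGaloisRep p) :
    ∃ (ℓ : ℕ) (_ : Fact ℓ.Prime), ℓ ≠ p ∧ W.HasGoodReductionAtPrime ℓ ∧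
      ¬ (p : ℤ) ∣ W.frobeniusTrace ℓ - (ℓ + 1) := by
  by_contra hne
  push Not at hne
  exact h W p (fun ℓ _ hℓp hgood ↦ hne ℓ ‹_› hℓp hgood) hirr


/-- **Darmon–Diamond–Taylor Prop. 2.6(b) (with 2.8(a), 2.11(a)) for `E[p]`, ARBITRARY FINITE EXCEPTIONAL SET** (named
fact): if `a_ℓ(E) ≡ ℓ + 1 (mod p)` for every prime `ℓ` of good reduction outside a finite set `S`, then `E[p]` is a
reducible `Γ_ℚ`-module.  Prop. 2.6(b) as printed: "a semi-simple mod `ℓ` representation `ρ : G_ℚ → GL_d(k)` is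
determined by the values of `tr ∧^i ρ(Frob_p)` (`i = 1, …, d`) on the primes `p ∉ S` at which `ρ` is unramified",
for ANY finite set `S` of primes containing those where `ρ` ramifies (proof: Chebotarev density + Brauer–Nesbitt); with
Prop. 2.11(a) (`tr ρ_{E,p}(Frob_ℓ) = ℓ + 1 − #Ẽ(𝔽_ℓ)` at good `ℓ ≠ p`) and Prop. 2.8(a) (`det = ε`) the hypothesis makes
`ρ̄_{E,p}^{ss} ≅ 1 ⊕ ε̄`, so `ρ̄_{E,p}` is reducible.  The tree's `not_irreducible_of_frobeniusTrace_congr` above is the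
instance `S = {p} ∪ {bad primes}` (`not_irreducible_of_frobeniusTrace_congr_of_off_finset`); the general `S` is the
form needed when the congruence is only known off the (uncontrolled) level of an auxiliary congruence subgroup — e.g.
the «Eisenstein end» of the relative Ihara lemma at a prime dividing the level (cell bsd-f2-manin, route
ManinLocalTwoThree, E-es-25). [cite: DarmonDiamondTaylor1995, Prop. 2.6(b), Prop. 2.8(a), Prop. 2.11(a) (PDF pp. 53–57)] -/
def not_irreducible_of_frobeniusTrace_congr_off_finset : Prop :=
  ∀ (W : WeierstrassCurve ℚ) [W.IsElliptic] [W.IsGloballyMinimal] (p : ℕ) [Fact p.Prime] (S : Finset ℕ),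
    (∀ (ℓ : ℕ) [Fact ℓ.Prime], ℓ ∉ S → W.HasGoodReductionAtPrime ℓ →
        (p : ℤ) ∣ W.frobeniusTrace ℓ - (ℓ + 1)) →
      ¬ W.HasIrreducibleModPGaloisRep p

/-- The finite-exceptional-set form implies the tree's form (take `S = {p}`; bad primes are excluded by the
good-reduction hypothesis). [cite: DarmonDiamondTaylor1995, Prop. 2.6(b) (PDF p. 53)] -/
theorem not_irreducible_of_frobeniusTrace_congr_of_off_finset
    (h : not_irreducible_of_frobeniusTrace_congr_off_finset) : not_irreducible_of_frobeniusTrace_congr := by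
  intro W _ _ p _ hcong
  exact h W p {p} fun ℓ _ hℓ hgood ↦ hcong ℓ (by simpa using hℓ) hgood

end Literature.NumberTheory.EllipticCurves
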